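import Literature.AnabelianGeometry.SemiGraphs.TemperedPiLevelKernelVerticial
import Literature.AnabelianGeometry.SemiGraphs.TemperedPiPresentationTowerInputs
import Literature.AnabelianGeometry.SemiGraphs.SubgroupPresentationTreeLevelVertexGenerated
import HarnessLib

/-!
# The tree level `ker ρ_n` is topologically generated by the vertex groups of the finite level `ker π_n`
# ([SemiAnbd] Prop 3.6 p. 38, Rmk 2.2.1 p. 24; classical Bass–Serre) — the binder `hgen` of the arithmetic tower DISCHARGED

Mochizuki, *Semi-graphs of anabelioids*, Publ. RIMS **42** (2006), Prop. 3.6 p. 38 ("`𝒢_{∞,i} → 𝒢_i` …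
the universal graph-covering of the underlying semi-graph `𝔾_i` [of `𝒢_i`]", whose deck group is
`π₁(𝔾_i)`) [cite: MochizukiSemiAnbd2006, Prop 3.6 p.38] and Rmk. 2.2.1 p. 24 (decomposition groups as
stabilisers, referring to [Serre, *Trees*] Ch. I) [cite: MochizukiSemiAnbd2006, Rem. 2.2.1 p.24].  The statement
proved here — the kernel of `π₁^temp(𝒢_i) ↠ π₁(𝔾_i)` is the closed normal subgroup generated by the
verticial subgroups — is NOT printed as such in [SemiAnbd]: it is implicit in the construction of p. 38 and
is classical Bass–Serre theory (Serre, *Trees*, I §5.4: the fundamental group of a graph of groups modulo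
the normal subgroup generated by the vertex groups is the fundamental group of the underlying graph).
(v2: attribution re-anchored per referee lane A pass A21, findings F3/F4 — doc-only; statements and proofs
byte-identical to v1 p430324.)

PROOF-ONLY (cell row T54-B, plan/GAP-LEDGER.md G-w4d053-1, sub-row **T54·E1c**; consumer: the binder
`hgen` of abc-iut-L3-d4's `GaloisLevelData.hK_of_vertGen`, `TemperedPiVertexGenerated.lean`).  At
abc-iut-L3-t9's Galois tower `D` (`temperedPi = lim_n Gal(𝒢_{∞,n}/𝒢)`, tree levels `ker ρ_n = ker projAut n`,
finite levels `ker π_n = ker piLevelAut n`) and abc-iut-L3-d4's presentation `P := D.piPresentation T R`: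

* `exists_ker_projAut_subset` — the tree levels `ker ρ_m` form a neighbourhood basis of `1` in
  `π₁^temp(𝒢)` (prodiscrete topology of the limit);
* `ker_projAut_le_sup_vertSup` — the ALGEBRAIC step at every deeper level `m ≥ n`:
  `ker ρ_n ≤ ker ρ_m ⊔ P.vertSup (ker π_n)`, by `SubgroupPresentation.le_sup_vertSup_of_isTree` (the
  deck group `ker ρ_n / ker ρ_m` of the tree `cosetGraph (ker ρ_m) ≅ 𝔾̃_m` over the tree
  `cosetGraph (ker ρ_n) ≅ 𝔾̃_n` is generated by its vertex stabilisers `(ker ρ_n ∩ g H_w g⁻¹)·ker ρ_m`);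
* **`ker_projAut_le_vertGen`** — `hgen : ∀ n, ker ρ_n ≤ P.vertGen (ker π_n)` VERBATIM, and the identity
  `vertGen_ker_piLevelAut_eq : P.vertGen (ker π_n) = ker ρ_n` (with abc-iut-L3-d4's reverse inclusion);
* **`hK_of_hN`** — abc-iut-L3-d4's E1 reduction `hK_of_vertGen` with `hgen` discharged: for a continuous
  arithmetically compatible action, Φ-stability of the finite levels `ker π_n` implies Φ-stability of the
  tree levels `ker ρ_n` (binder `hK` of `ArithTreeTower.lean` ⟸ binder `hN` of `ArithLevelTower.lean`).

Nothing here refers to the IUT corpus; no side is taken on [IUTchIII] Cor 3.12; typed ≠ proved for Thm 5.4 itself.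
-/

namespace Literature.AnabelianGeometry.SemiGraphs

namespace ProfiniteSemiGraph

namespace GaloisLevelData

open CategoryTheory Topology
open scoped Pointwise

universe u v

variable {𝒢 : ProfiniteSemiGraph.{u}} (D : GaloisLevelData 𝒢) (h𝒢 : 𝒢.IsCountable)
  (hconn : ∀ (n : ℕ) (p q : (D.S n).Point), (D.S n).SameComponent p q)
  (T : ∀ w : 𝒢.graph.Vertex, D.PointSeq h𝒢 w) (R : SemiGraph.RefBranches 𝒢.graph)

/-! ### The tree levels form a neighbourhood basis of `1` -/

/-- **The tree levels `ker ρ_m` form a neighbourhood basis of `1` in `π₁^temp(𝒢)`** (the topology of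
`lim_m Gal(𝒢_{∞,m}/𝒢) ≤ ∏_m Gal(𝒢_{∞,m}/𝒢)` is induced from the product of the discrete `Gal`'s, and a
basic neighbourhood constrains finitely many coordinates, all determined by a deeper one).
[cite: MochizukiSemiAnbd2006, Prop 3.6(i) p.38] -/
theorem exists_ker_projAut_subset {U : Set (D.temperedPi h𝒢)} (hU : U ∈ 𝓝 (1 : D.temperedPi h𝒢)) :
    ∃ m : ℕ, ((D.projAut h𝒢 m).ker : Set (D.temperedPi h𝒢)) ⊆ U := by
  have hU' : U ∈ 𝓝 ((1 : (D.system h𝒢).limit)) := hU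
  obtain ⟨u, hu, hsub⟩ := (mem_nhds_subtype _ _ _).mp hU'
  rw [Subgroup.coe_one, nhds_pi, Filter.mem_pi] at hu
  obtain ⟨I, hI, t, ht, hIt⟩ := hu
  obtain ⟨k, hk⟩ := hI.toFinset.exists_le
  refine ⟨k.down, fun g hg => ?_⟩
  -- read `g` as a compatible family `(g_i)_i ∈ lim_i Gal_i ≤ ∏_i Gal_i`
  set g' : (D.system h𝒢).limit := g
  have hgk : g'.1 k = 1 := hg
  have hmem : g'.1 ∈ I.pi t := by
    intro i hi
    have hik : i ≤ k := hk i (hI.mem_toFinset.mpr hi)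
    have h2 : (D.system h𝒢).map hik (g'.1 k) = g'.1 i := g'.2 hik
    have h3 : g'.1 i = 1 := by rw [← h2, hgk, map_one]
    rw [h3]
    have h4 := ht i
    rwa [nhds_discrete, Filter.mem_pure] at h4
  exact hsub (hIt hmem)

/-! ### The algebraic step at a deeper tree level -/

/-- **`ker ρ_n ≤ ker ρ_m ⊔ P.vertSup (ker π_n)` for `n ≤ m`**: the tree levels `cosetGraph (ker ρ_m)`,
`cosetGraph (ker ρ_n)` are trees (`piPresentation_hT`), so `ker ρ_n ≤ ker ρ_m ⊔ P.vertSup (ker ρ_n)`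
(`SubgroupPresentation.le_sup_vertSup_of_isTree`), and `vertSup` is monotone along `ker ρ_n ≤ ker π_n`.
[cite: MochizukiSemiAnbd2006, Prop 3.6 p.38] -/
theorem ker_projAut_le_sup_vertSup {n m : ℕ} (hnm : n ≤ m) :
    (D.projAut h𝒢 n).ker ≤
      (D.projAut h𝒢 m).ker ⊔ (D.piPresentation h𝒢 T R).vertSup (D.piLevelAut h𝒢 hconn n).ker := by
  have hK : ((D.piPresentation h𝒢 T R).cosetGraph (D.projAut h𝒢 m).ker).IsConnected :=
    ⟨(D.piPresentation_hT h𝒢 T R m).isTree.connected⟩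
  have h := (D.piPresentation h𝒢 T R).le_sup_vertSup_of_isTree (D.ker_projAut_anti h𝒢 hnm) hK
    (D.piPresentation_hT h𝒢 T R n) D.v₀
  exact le_trans h (sup_le_sup_left
    ((D.piPresentation h𝒢 T R).vertSup_mono (D.ker_projAut_le_ker_piLevelAut h𝒢 hconn n)) _)

/-! ### `hgen`: the tree level is the verticially generated part of the finite level -/

/-- **`hgen` DISCHARGED: `ker ρ_n ≤ P.vertGen (ker π_n)`** — the kernel of `π₁^temp(𝒢_{S n}) ↠ π₁(𝔾_{S n})`
is topologically generated by the verticial subgroups `ker π_n ∩ g H_w g⁻¹`: by the algebraic step,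
`ker ρ_n ≤ ⋂_{m ≥ n} (P.vertSup (ker π_n) · ker ρ_m)`, and the right side lies in the closure of
`P.vertSup (ker π_n)` because the `ker ρ_m` form a neighbourhood basis of `1`.
[cite: MochizukiSemiAnbd2006, Prop 3.6 p.38] -/
theorem ker_projAut_le_vertGen (n : ℕ) :
    (D.projAut h𝒢 n).ker ≤ (D.piPresentation h𝒢 T R).vertGen (D.piLevelAut h𝒢 hconn n).ker := by
  intro x hx
  change x ∈ closure (((D.piPresentation h𝒢 T R).vertSup (D.piLevelAut h𝒢 hconn n).ker :
    Subgroup (D.temperedPi h𝒢)) : Set (D.temperedPi h𝒢))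
  rw [mem_closure_iff_nhds]
  intro t ht
  -- the right translate `{g | g x ∈ t}` is a neighbourhood of `1`; it contains some `ker ρ_m`, `m ≥ n`
  have hU : (fun g : D.temperedPi h𝒢 => g * x) ⁻¹' t ∈ 𝓝 (1 : D.temperedPi h𝒢) := by
    have hc : Continuous fun g : D.temperedPi h𝒢 => g * x := continuous_id.mul continuous_const
    refine hc.continuousAt.preimage_mem_nhds ?_
    rwa [one_mul]
  obtain ⟨m, hm⟩ := D.exists_ker_projAut_subset h𝒢 hU
  -- `x = k v` with `k ∈ ker ρ_{max n m}`, `v ∈ vertSup (ker π_n)`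
  have hxm := D.ker_projAut_le_sup_vertSup h𝒢 hconn T R (le_max_left n m) hx
  have hxm' : x ∈ (((D.projAut h𝒢 (max n m)).ker : Subgroup (D.temperedPi h𝒢)) : Set (D.temperedPi h𝒢)) *
      (((D.piPresentation h𝒢 T R).vertSup (D.piLevelAut h𝒢 hconn n).ker :
        Subgroup (D.temperedPi h𝒢)) : Set (D.temperedPi h𝒢)) := by
    rw [← Subgroup.normal_mul]
    exact hxm
  obtain ⟨k, hk, v, hv, hkv⟩ := Set.mem_mul.mp hxm'
  -- then `v = k⁻¹ x ∈ t`
  refine ⟨v, ?_, hv⟩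
  have hv' : k⁻¹ * x = v := by rw [← hkv]; group
  rw [← hv']
  exact hm (D.ker_projAut_anti h𝒢 (le_max_right n m) (Subgroup.inv_mem _ hk))

/-- **`P.vertGen (ker π_n) = ker ρ_n`**: the verticially generated part of the finite level IS the tree
level (abc-iut-L3-d4's `vertGen_ker_piLevelAut_le` and `ker_projAut_le_vertGen`).
[cite: MochizukiSemiAnbd2006, Prop 3.6 p.38] -/
theorem vertGen_ker_piLevelAut_eq (n : ℕ) :
    (D.piPresentation h𝒢 T R).vertGen (D.piLevelAut h𝒢 hconn n).ker = (D.projAut h𝒢 n).ker :=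
  le_antisymm (D.vertGen_ker_piLevelAut_le h𝒢 hconn T R n) (D.ker_projAut_le_vertGen h𝒢 hconn T R n)

/-- The closed form of the algebraic identity at every pair of levels `n ≤ m`:
`ker ρ_n = ker ρ_m ⊔ P.vertSup (ker ρ_n)` (the deck group `Gal(𝒢_{∞,m}/𝒢_{∞,n})` is generated by its
vertex stabilisers). [cite: MochizukiSemiAnbd2006, Prop 3.6 p.38] -/
theorem ker_projAut_eq_sup_vertSup {n m : ℕ} (hnm : n ≤ m) :
    (D.projAut h𝒢 n).ker =
      (D.projAut h𝒢 m).ker ⊔ (D.piPresentation h𝒢 T R).vertSup (D.projAut h𝒢 n).ker :=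
  (D.piPresentation h𝒢 T R).eq_sup_vertSup_of_isTree (D.ker_projAut_anti h𝒢 hnm)
    ⟨(D.piPresentation_hT h𝒢 T R m).isTree.connected⟩ (D.piPresentation_hT h𝒢 T R n) D.v₀

/-! ### E1: Φ-stability of the tree levels from that of the finite levels -/

/-- **E1 closed (abc-iut-L3-d4's `hK_of_vertGen` with `hgen` discharged)**: for a continuous arithmetically
compatible action `Φ` of `E` on `π₁^temp(𝒢)`, if every `Φ_e` stabilises every finite level `ker π_n`
(binder `hN` of `ArithLevelTower.lean`), then every `Φ_e` stabilises every tree level `ker ρ_n` (binder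
`hK` of `ArithTreeTower.lean`). [cite: MochizukiSemiAnbd2006, Thm 5.4, p. 66] -/
theorem hK_of_hN {E : Type v} [Group E] {Φ : E →* MulAut (D.temperedPi h𝒢)}
    {σ : E →* Aut 𝒢.graph} (hP : (D.piPresentation h𝒢 T R).IsArithCompatible Φ σ)
    (hc : ∀ e : E, Continuous (Φ e))
    (hN : ∀ (n : ℕ) (e : E) (x : D.temperedPi h𝒢),
      x ∈ (D.piLevelAut h𝒢 hconn n).ker → Φ e x ∈ (D.piLevelAut h𝒢 hconn n).ker)
    (n : ℕ) (e : E) (x : D.temperedPi h𝒢) (hx : x ∈ (D.projAut h𝒢 n).ker) :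
    Φ e x ∈ (D.projAut h𝒢 n).ker :=
  D.hK_of_vertGen h𝒢 hconn T R hP hc (D.ker_projAut_le_vertGen h𝒢 hconn T R) hN n e x hx

end GaloisLevelData

end ProfiniteSemiGraph

end Literature.AnabelianGeometry.SemiGraphs
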